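import Literature.Probability.LatticeModels.SixVertexSpectralMeasureConvergence
import Literature.Probability.LatticeModels.SixVertexSpectralIntegrands
import Mathlib.Analysis.Calculus.ParametricIntegral
import Mathlib.Analysis.SpecialFunctions.ExpDeriv
import Mathlib.MeasureTheory.Integral.DominatedConvergence
import Mathlib.MeasureTheory.Integral.IntervalIntegral.FundThmCalculus

/-!
# The functions `F` and `I_F` of a spectral measure (DKLM 2026, Part II, Definition 36 and Lemma 37)

H. Duminil-Copin, K. K. Kozlowski, P. Lammers, I. Manolescu, *Gaussian free field convergence of
the six-vertex model with `-1 ≤ Δ ≤ -1/2`*, arXiv:2603.06268 (2026) [DKLM2026SixVertexGFF]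
(`paper:arxiv-2603.06268`, chunks p0024–p0025):

> (eq:chi_u_def) `χ_u(a,b) := (e^{-ax₂-iby₂} - 1) e^{-ax₁'-iby₁'} (1 - e^{-ax₁-iby₁})`. […]
> `Ψ₂(u) = ∫ χ_u(a,b) dμ(a,b)`.
>
> **Definition 36.** To a convergence sequence `(δ_n)_n`, associate the following functions:
> `F : ℂ_+ × ℝ → ℂ, (x,y) ↦ ∫ a e^{-ax-iby} dμ(a,b)`, `I_F : ℝ_{>0} → ℝ, s ↦ -∫_1^s F(x,0) dx`.
> The bounds in the definition of `𝓜` ensure that the above functions are indeed well-defined. In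
> the definition of `I_F`, the integral is taken with a sign, so that `I_F'(s) = -F(s,0)` for all
> `s > 0`.
>
> **Lemma 37.** For every convergence sequence, the function `F` satisfies: (i) for any
> horizontally strictly ordered `(u₁,u₁',u₂,u₂')`,
> `lim_{ε→0} ε⁻¹ Ψ₂(u₁,u₁',u₂,u₂+(ε,0)) = F(x₁+x₁', y₁+y₁') - F(x₁', y₁')`; (ii) `F` is continuous
> on `ℂ_+ × ℝ`; (iii) for any fixed `y`, `F(·,y)` is holomorphic on `ℂ_+`; (iv)
> `|F(x,y)| ≤ F(Re(x),0)`, and `F(x,0)` is decreasing in `x ∈ ℝ_{>0}`; (v) `lim_{x→∞} F(x,0) = 0`.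
> Proof. All properties follow from (eq:initial_scaling), the bounds in the definition of `𝓜` and
> the dominated convergence theorem with the dominating function `a ∧ 1/a`.

Everything is stated for a measure `μ ∈ 𝓜_{c,C}` (Definition 29; the sub-sequential limits of
the spectral measures are such measures), with `Ψ_μ(u) := ∫ χ_u dμ` in place of `Ψ₂` (they agree
by Lemma 34, eq. (eq:initial_scaling)):

* `dklmPsi μ` (`Ψ_μ := ∫ χ_u dμ` with `χ_u = chiCont` of `SixVertexSpectralIntegrands.lean`), `fKernel x y (a,b) = a e^{-ax-iby}`, **`dklmF μ = F`**,
  **`dklmIF μ = I_F`** (Definition 36);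
* domination: `mul_exp_neg_le_min_inv` (`a e^{-ax₀} ≤ K(x₀) (a ∧ 1/a)`), `sq_mul_exp_neg_le_min_inv`,
  `dklmSpaceM_integrable_fKernel`;
* **Lemma 37**: (i) `tendsto_dklmPsi_div`, (ii) `continuousOn_dklmF`, (iii)
  `differentiableOn_dklmF`, (iv) `norm_dklmF_le`, `dklmF_re_antitone`, (v) `tendsto_dklmF_atTop`;
  and `hasDerivAt_dklmIF` (`I_F' = -F(·,0)`).

## References

* H. Duminil-Copin, K. K. Kozlowski, P. Lammers, I. Manolescu, arXiv:2603.06268 (2026), Part II,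
  eq. (chi_u_def), Definition 36, Lemma 37. [DKLM2026SixVertexGFF]
-/

noncomputable section

open MeasureTheory Set Filter Topology

namespace Literature.Probability.LatticeModels.SixVertex

/-! ## 1. The objects -/

/-- **`Ψ_μ(u) := ∫ χ_u dμ`** (the spectral representation of the scaling limit, eq. (initial_scaling)).
[cite: DKLM2026SixVertexGFF, Part II, Lemma 34] -/
def dklmPsi (μ : Measure (ℝ × ℝ)) (x₁ y₁ x₁' y₁' x₂ y₂ : ℝ) : ℂ :=
  ∫ p, chiCont x₁ y₁ x₁' y₁' x₂ y₂ p ∂μ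

/-- The integrand `a e^{-ax-iby}` of `F`. [cite: DKLM2026SixVertexGFF, Part II, Definition 36] -/
def fKernel (x : ℂ) (y : ℝ) (p : ℝ × ℝ) : ℂ :=
  (p.1 : ℂ) * Complex.exp (-((p.1 : ℂ) * x + Complex.I * p.2 * y))

/-- **Definition 36: `F(x,y) := ∫ a e^{-ax-iby} dμ(a,b)`** for `x ∈ ℂ_+`, `y ∈ ℝ`.
[cite: DKLM2026SixVertexGFF, Part II, Definition 36] -/
def dklmF (μ : Measure (ℝ × ℝ)) (x : ℂ) (y : ℝ) : ℂ := ∫ p, fKernel x y p ∂μ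

/-- **Definition 36: `I_F(s) := -∫_1^s F(x,0) dx`** (`F(x,0)` is real for real `x > 0`).
[cite: DKLM2026SixVertexGFF, Part II, Definition 36] -/
def dklmIF (μ : Measure (ℝ × ℝ)) (s : ℝ) : ℝ := -∫ x in (1 : ℝ)..s, (dklmF μ x 0).re

/-! ## 2. The kernel: size and domination by `a ∧ 1/a` -/

/-- `|a e^{-ax-iby}| = a e^{-a Re x}` for `a > 0`. [folklore] -/
theorem norm_fKernel (x : ℂ) (y : ℝ) {p : ℝ × ℝ} (hp : 0 < p.1) :
    ‖fKernel x y p‖ = p.1 * Real.exp (-(p.1 * x.re)) := by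
  rw [fKernel, norm_mul, Complex.norm_real, Real.norm_eq_abs, abs_of_pos hp, Complex.norm_exp]
  congr 2
  simp [Complex.mul_re, Complex.mul_im]

/-- `t² ≤ 2 eᵗ` for `t ≥ 0`. [folklore] -/
theorem sq_le_two_mul_exp {t : ℝ} (ht : 0 ≤ t) : t ^ 2 ≤ 2 * Real.exp t := by
  have h := Real.pow_div_factorial_le_exp t ht 2
  norm_num [Nat.factorial] at h
  linarith

/-- `t³ ≤ 6 eᵗ` for `t ≥ 0`. [folklore] -/
theorem cube_le_six_mul_exp {t : ℝ} (ht : 0 ≤ t) : t ^ 3 ≤ 6 * Real.exp t := by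
  have h := Real.pow_div_factorial_le_exp t ht 3
  norm_num [Nat.factorial] at h
  linarith

/-- **Domination**: `a e^{-a x₀} ≤ max(1, 2/x₀²) (a ∧ 1/a)` for `a, x₀ > 0`.
[cite: DKLM2026SixVertexGFF, Part II, proof of Lemma 37] -/
theorem mul_exp_neg_le_min_inv {a x₀ : ℝ} (ha : 0 < a) (hx₀ : 0 < x₀) :
    a * Real.exp (-(a * x₀)) ≤ max 1 (2 / x₀ ^ 2) * min a a⁻¹ := by
  have hexp1 : Real.exp (-(a * x₀)) ≤ 1 := Real.exp_le_one_iff.2 (by nlinarith)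
  rcases le_or_gt a 1 with h1 | h1
  · have hmin : min a a⁻¹ = a := min_eq_left ((le_of_eq (by simp)).trans (one_le_inv_iff₀.2 ⟨ha, h1⟩) |> h1.trans)
    rw [hmin]
    calc a * Real.exp (-(a * x₀)) ≤ a * 1 := by gcongr
      _ = 1 * a := by ring
      _ ≤ max 1 (2 / x₀ ^ 2) * a := by gcongr; exact le_max_left _ _
  · have hmin : min a a⁻¹ = a⁻¹ := min_eq_right ((inv_le_one_of_one_le₀ h1.le).trans h1.le)
    rw [hmin]
    have key : (a * x₀) ^ 2 * Real.exp (-(a * x₀)) ≤ 2 := by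
      have h := sq_le_two_mul_exp (by positivity : 0 ≤ a * x₀)
      rw [Real.exp_neg]
      rw [mul_inv_le_iff₀ (Real.exp_pos _)]
      linarith
    calc a * Real.exp (-(a * x₀)) = ((a * x₀) ^ 2 * Real.exp (-(a * x₀))) / (x₀ ^ 2 * a) := by
          field_simp
        _ ≤ 2 / (x₀ ^ 2 * a) := by gcongr
        _ = 2 / x₀ ^ 2 * a⁻¹ := by rw [div_mul_eq_div_div, div_eq_mul_inv]
        _ ≤ max 1 (2 / x₀ ^ 2) * a⁻¹ := by gcongr; exact le_max_right _ _

/-- **Domination of the derivative kernel**: `a² e^{-a x₀} ≤ max(1, 6/x₀³) (a ∧ 1/a)` for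
`a, x₀ > 0`. [cite: DKLM2026SixVertexGFF, Part II, proof of Lemma 37] -/
theorem sq_mul_exp_neg_le_min_inv {a x₀ : ℝ} (ha : 0 < a) (hx₀ : 0 < x₀) :
    a ^ 2 * Real.exp (-(a * x₀)) ≤ max 1 (6 / x₀ ^ 3) * min a a⁻¹ := by
  have hexp1 : Real.exp (-(a * x₀)) ≤ 1 := Real.exp_le_one_iff.2 (by nlinarith)
  rcases le_or_gt a 1 with h1 | h1
  · have hmin : min a a⁻¹ = a := min_eq_left (h1.trans (one_le_inv_iff₀.2 ⟨ha, h1⟩))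
    rw [hmin]
    calc a ^ 2 * Real.exp (-(a * x₀)) ≤ a ^ 2 * 1 := by gcongr
      _ ≤ 1 * a := by nlinarith
      _ ≤ max 1 (6 / x₀ ^ 3) * a := by gcongr; exact le_max_left _ _
  · have hmin : min a a⁻¹ = a⁻¹ := min_eq_right ((inv_le_one_of_one_le₀ h1.le).trans h1.le)
    rw [hmin]
    have key : (a * x₀) ^ 3 * Real.exp (-(a * x₀)) ≤ 6 := by
      have h := cube_le_six_mul_exp (by positivity : 0 ≤ a * x₀)
      rw [Real.exp_neg, mul_inv_le_iff₀ (Real.exp_pos _)]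
      linarith
    calc a ^ 2 * Real.exp (-(a * x₀)) = ((a * x₀) ^ 3 * Real.exp (-(a * x₀))) / (x₀ ^ 3 * a) := by
          field_simp
        _ ≤ 6 / (x₀ ^ 3 * a) := by gcongr
        _ = 6 / x₀ ^ 3 * a⁻¹ := by rw [div_mul_eq_div_div, div_eq_mul_inv]
        _ ≤ max 1 (6 / x₀ ^ 3) * a⁻¹ := by gcongr; exact le_max_right _ _

/-- The kernel is dominated on `{Re x ≥ x₀}`: `|a e^{-ax-iby}| ≤ max(1, 2/x₀²) (a ∧ 1/a)`.
[cite: DKLM2026SixVertexGFF, Part II, proof of Lemma 37] -/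
theorem norm_fKernel_le {x₀ : ℝ} (hx₀ : 0 < x₀) {x : ℂ} (hx : x₀ ≤ x.re) (y : ℝ) {p : ℝ × ℝ} (hp : 0 < p.1) :
    ‖fKernel x y p‖ ≤ max 1 (2 / x₀ ^ 2) * min p.1 p.1⁻¹ := by
  rw [norm_fKernel x y hp]
  calc p.1 * Real.exp (-(p.1 * x.re)) ≤ p.1 * Real.exp (-(p.1 * x₀)) := by
        gcongr
    _ ≤ max 1 (2 / x₀ ^ 2) * min p.1 p.1⁻¹ := mul_exp_neg_le_min_inv hp hx₀

/-- The kernel is continuous in `(a,b)`. [folklore] -/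
theorem continuous_fKernel (x : ℂ) (y : ℝ) : Continuous (fKernel x y) := by
  unfold fKernel
  fun_prop

/-- The kernel is continuous in `(x,y)`. [folklore] -/
theorem continuous_fKernel_param (p : ℝ × ℝ) : Continuous fun q : ℂ × ℝ => fKernel q.1 q.2 p := by
  unfold fKernel
  fun_prop

variable {c C : ℝ} {ν : Measure (ℝ × ℝ)}

/-- **`F` is well defined**: the kernel is `ν`-integrable for `ν ∈ 𝓜_{c,C}` and `Re x > 0`.
[cite: DKLM2026SixVertexGFF, Part II, Definition 36] -/
theorem dklmSpaceM_integrable_fKernel (h : ν ∈ dklmSpaceM c C) {x : ℂ} (hx : 0 < x.re) (y : ℝ) :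
    Integrable (fKernel x y) ν :=
  dklmSpaceM_integrable h (continuous_fKernel x y).continuousOn (by positivity)
    fun p hp => norm_fKernel_le (half_pos hx) (by linarith) y hp

/-! ## 3. Lemma 37 (iv): `|F(x,y)| ≤ F(Re x, 0)`, and `F(·,0)` is decreasing -/

/-- `F(x,0) = ∫ a e^{-ax} dν` for real `x`. [cite: DKLM2026SixVertexGFF, Part II, Definition 36] -/
theorem dklmF_ofReal_zero (ν : Measure (ℝ × ℝ)) (x : ℝ) :
    dklmF ν x 0 = ((∫ p, p.1 * Real.exp (-(p.1 * x)) ∂ν : ℝ) : ℂ) := by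
  have hfun : fKernel (x : ℂ) 0 = fun p : ℝ × ℝ => ((p.1 * Real.exp (-(p.1 * x)) : ℝ) : ℂ) := by
    funext p
    simp only [fKernel, Complex.ofReal_zero, mul_zero, add_zero]
    push_cast
    ring_nf
  rw [dklmF, hfun]
  exact integral_ofReal

/-- **Lemma 37 (iv)**: `|F(x,y)| ≤ F(Re x, 0)`. [cite: DKLM2026SixVertexGFF, Part II, Lemma 37 (iv)] -/
theorem norm_dklmF_le (h : ν ∈ dklmSpaceM c C) (x : ℂ) (y : ℝ) :
    ‖dklmF ν x y‖ ≤ (dklmF ν (x.re : ℂ) 0).re := by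
  rw [dklmF_ofReal_zero ν, Complex.ofReal_re]
  calc ‖dklmF ν x y‖ ≤ ∫ p, ‖fKernel x y p‖ ∂ν := norm_integral_le_integral_norm _
    _ = ∫ p, p.1 * Real.exp (-(p.1 * x.re)) ∂ν := by
        refine integral_congr_ae ?_
        filter_upwards [dklmSpaceM_ae_pos h] with p hp
        exact norm_fKernel x y hp

/-- **Lemma 37 (iv)**: `x ↦ F(x,0)` is decreasing on `ℝ_{>0}`. [cite: DKLM2026SixVertexGFF, Part II, Lemma 37 (iv)] -/
theorem dklmF_re_antitone (h : ν ∈ dklmSpaceM c C) {x x' : ℝ} (hx : 0 < x) (hxx' : x ≤ x') :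
    (dklmF ν x' 0).re ≤ (dklmF ν x 0).re := by
  rw [dklmF_ofReal_zero ν, dklmF_ofReal_zero ν, Complex.ofReal_re, Complex.ofReal_re]
  have hint : ∀ z : ℝ, 0 < z → Integrable (fun p : ℝ × ℝ => p.1 * Real.exp (-(p.1 * z))) ν := by
    intro z hz
    refine dklmSpaceM_integrable h (K := max 1 (2 / z ^ 2)) (Continuous.continuousOn (by fun_prop)) (by positivity)
      fun p hp => ?_
    rw [Real.norm_eq_abs, abs_of_pos (mul_pos hp (Real.exp_pos _))]
    exact mul_exp_neg_le_min_inv hp hz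
  refine integral_mono_ae (hint x' (hx.trans_le hxx')) (hint x hx) ?_
  filter_upwards [dklmSpaceM_ae_pos h] with p hp
  have : p.1 * x ≤ p.1 * x' := by nlinarith
  gcongr

/-! ## 4. Lemma 37 (v): `F(x,0) → 0` as `x → ∞` -/

/-- **Lemma 37 (v)**: `lim_{x → ∞} F(x,0) = 0` (dominated convergence).
[cite: DKLM2026SixVertexGFF, Part II, Lemma 37 (v)] -/
theorem tendsto_dklmF_atTop (h : ν ∈ dklmSpaceM c C) :
    Tendsto (fun x : ℝ => dklmF ν x 0) atTop (𝓝 0) := by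
  have h0 : (0 : ℂ) = ∫ _ : ℝ × ℝ, (0 : ℂ) ∂ν := by simp
  rw [h0]
  refine tendsto_integral_filter_of_dominated_convergence (fun p => max 1 (2 / 1 ^ 2) * min p.1 p.1⁻¹)
    (Eventually.of_forall fun x => (continuous_fKernel _ _).aestronglyMeasurable) ?_
    (dklmSpaceM_integrable_min_inv h (by positivity)) ?_
  · filter_upwards [eventually_ge_atTop (1 : ℝ)] with x hx
    filter_upwards [dklmSpaceM_ae_pos h] with p hp
    exact norm_fKernel_le one_pos (by simpa using hx) 0 hp
  · filter_upwards [dklmSpaceM_ae_pos h] with p hp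
    rw [tendsto_zero_iff_norm_tendsto_zero]
    have : (fun x : ℝ => ‖fKernel (x : ℂ) 0 p‖) = fun x => p.1 * Real.exp (-(p.1 * x)) := by
      funext x; rw [norm_fKernel _ _ hp, Complex.ofReal_re]
    rw [this, ← mul_zero p.1]
    refine Tendsto.const_mul _ (Real.tendsto_exp_atBot.comp ?_)
    exact tendsto_neg_atTop_atBot.comp (tendsto_id.const_mul_atTop hp)

/-! ## 5. Lemma 37 (ii): continuity of `F` on `ℂ_+ × ℝ` -/

/-- **Lemma 37 (ii)**: `F` is continuous on `ℂ_+ × ℝ`. [cite: DKLM2026SixVertexGFF, Part II, Lemma 37 (ii)] -/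
theorem continuousOn_dklmF (h : ν ∈ dklmSpaceM c C) :
    ContinuousOn (fun q : ℂ × ℝ => dklmF ν q.1 q.2) {q : ℂ × ℝ | 0 < q.1.re} := by
  refine continuousOn_of_forall_continuousAt fun q₀ hq₀ => ?_
  set r : ℝ := q₀.1.re with hr
  have hr0 : 0 < r := hq₀
  have hS : IsOpen {q : ℂ × ℝ | r / 2 < q.1.re} :=
    isOpen_lt continuous_const (Complex.continuous_re.comp continuous_fst)
  have hcont : ContinuousOn (fun q : ℂ × ℝ => dklmF ν q.1 q.2) {q : ℂ × ℝ | r / 2 < q.1.re} := by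
    refine continuousOn_of_dominated (bound := fun p => max 1 (2 / (r / 2) ^ 2) * min p.1 p.1⁻¹)
      (fun q _ => (continuous_fKernel _ _).aestronglyMeasurable) (fun q hq => ?_)
      (dklmSpaceM_integrable_min_inv h (by positivity))
      (ae_of_all _ fun p => (continuous_fKernel_param p).continuousOn)
    filter_upwards [dklmSpaceM_ae_pos h] with p hp
    exact norm_fKernel_le (half_pos hr0) (le_of_lt hq) _ hp
  exact hcont.continuousAt (hS.mem_nhds (by show r / 2 < q₀.1.re; linarith))

/-- `x ↦ F(x,0)` is continuous on `ℝ_{>0}` (real part, real argument). [cite: DKLM2026SixVertexGFF, Part II, Lemma 37 (ii)] -/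
theorem continuousOn_dklmF_re (h : ν ∈ dklmSpaceM c C) :
    ContinuousOn (fun x : ℝ => (dklmF ν x 0).re) (Ioi 0) := by
  have h1 : ContinuousOn (fun x : ℝ => ((x : ℂ), (0 : ℝ))) (Ioi 0) := by fun_prop
  have h2 := (continuousOn_dklmF h).comp h1 (fun x hx => by simpa using hx)
  exact Complex.continuous_re.comp_continuousOn h2

/-! ## 6. Lemma 37 (iii): holomorphy in `x` -/

/-- **Lemma 37 (iii)**: for fixed `y`, `F(·, y)` is holomorphic on `ℂ_+`, with
`∂_x F(x,y) = -∫ a² e^{-ax-iby} dν`. [cite: DKLM2026SixVertexGFF, Part II, Lemma 37 (iii)] -/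
theorem hasDerivAt_dklmF (h : ν ∈ dklmSpaceM c C) {x₀ : ℂ} (hx₀ : 0 < x₀.re) (y : ℝ) :
    HasDerivAt (fun x => dklmF ν x y) (∫ p, -(p.1 : ℂ) * fKernel x₀ y p ∂ν) x₀ := by
  set r : ℝ := x₀.re with hr
  have hs : {x : ℂ | r / 2 < x.re} ∈ 𝓝 x₀ :=
    (isOpen_lt continuous_const Complex.continuous_re).mem_nhds (by show r / 2 < x₀.re; linarith)
  have hderiv : ∀ (p : ℝ × ℝ) (x : ℂ), HasDerivAt (fun x => fKernel x y p) (-(p.1 : ℂ) * fKernel x y p) x := by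
    intro p x
    have h1 : HasDerivAt (fun x : ℂ => -((p.1 : ℂ) * x + Complex.I * p.2 * y)) (-(p.1 : ℂ)) x := by
      have := ((hasDerivAt_id x).const_mul (-(p.1 : ℂ))).add_const (-(Complex.I * p.2 * y))
      refine (this.congr_of_eventuallyEq (Eventually.of_forall fun z => ?_)).congr_deriv (by ring)
      simp only [id]
      ring
    have h2 := (h1.cexp).const_mul (p.1 : ℂ)
    refine h2.congr_deriv ?_
    simp only [fKernel]
    ring
  refine (hasDerivAt_integral_of_dominated_loc_of_deriv_le (bound := fun p => max 1 (6 / (r / 2) ^ 3) * min p.1 p.1⁻¹)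
    (F := fun x => fKernel x y) (F' := fun x p => -(p.1 : ℂ) * fKernel x y p)
    hs (Eventually.of_forall fun x => (continuous_fKernel _ _).aestronglyMeasurable)
    (dklmSpaceM_integrable_fKernel h hx₀ y) ?_ ?_ (dklmSpaceM_integrable_min_inv h (by positivity))
    (ae_of_all _ fun p x _ => hderiv p x)).2
  · exact (Continuous.aestronglyMeasurable (by unfold fKernel; fun_prop))
  · filter_upwards [dklmSpaceM_ae_pos h] with p hp x hx
    rw [norm_mul, norm_neg, Complex.norm_real, Real.norm_eq_abs, abs_of_pos hp, norm_fKernel _ _ hp]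
    calc p.1 * (p.1 * Real.exp (-(p.1 * x.re))) ≤ p.1 ^ 2 * Real.exp (-(p.1 * (r / 2))) := by
          rw [← mul_assoc, ← sq]; gcongr
      _ ≤ max 1 (6 / (r / 2) ^ 3) * min p.1 p.1⁻¹ := sq_mul_exp_neg_le_min_inv hp (half_pos hx₀)

/-- **Lemma 37 (iii)**: `F(·,y)` is complex differentiable on `ℂ_+`. [cite: DKLM2026SixVertexGFF, Part II, Lemma 37 (iii)] -/
theorem differentiableOn_dklmF (h : ν ∈ dklmSpaceM c C) (y : ℝ) :
    DifferentiableOn ℂ (fun x => dklmF ν x y) {x : ℂ | 0 < x.re} := fun _ hx =>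
  (hasDerivAt_dklmF h hx y).differentiableAt.differentiableWithinAt

/-! ## 7. `I_F' = -F(·,0)` -/

/-- **`I_F'(s) = -F(s,0)`** for `s > 0`. [cite: DKLM2026SixVertexGFF, Part II, Definition 36] -/
theorem hasDerivAt_dklmIF (h : ν ∈ dklmSpaceM c C) {s : ℝ} (hs : 0 < s) :
    HasDerivAt (dklmIF ν) (-(dklmF ν s 0).re) s := by
  have hcont := continuousOn_dklmF_re h
  have hint : IntervalIntegrable (fun x : ℝ => (dklmF ν x 0).re) volume 1 s := by
    refine (hcont.mono ?_).intervalIntegrable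
    intro x hx
    rw [mem_Ioi]
    rcases le_total 1 s with h1 | h1
    · rw [uIcc_of_le h1] at hx; linarith [hx.1]
    · rw [uIcc_of_ge h1] at hx; linarith [hx.1]
  have hderiv := intervalIntegral.integral_hasDerivAt_right hint
    (hcont.stronglyMeasurableAtFilter isOpen_Ioi s hs) (hcont.continuousAt (isOpen_Ioi.mem_nhds hs))
  exact hderiv.neg

/-! ## 8. Lemma 37 (i): the horizontal derivative of `Ψ` -/

/-- `1 - e^{-t} ≤ t` and `e^{-t} ≤ 1` give `|e^{-t} - 1| ≤ t` for `t ≥ 0`. [folklore] -/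
theorem norm_cexp_neg_sub_one_le {t : ℝ} (ht : 0 ≤ t) : ‖Complex.exp (-(t : ℂ)) - 1‖ ≤ t := by
  rw [show Complex.exp (-(t : ℂ)) - 1 = ((Real.exp (-t) - 1 : ℝ) : ℂ) by push_cast; ring_nf, Complex.norm_real,
    Real.norm_eq_abs, abs_sub_comm, abs_of_nonneg (by linarith [Real.exp_le_one_iff.2 (neg_nonpos.2 ht)])]
  linarith [Real.add_one_le_exp (-t)]

/-- **Lemma 37 (i)**: for `x₁ ≥ 0`, `x₁' > 0` and any `y₁, y₁'`,
`lim_{ε → 0⁺} ε⁻¹ Ψ_μ(u₁,u₁',u₂,u₂+(ε,0)) = F(x₁+x₁', y₁+y₁') - F(x₁', y₁')`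
(`x₂ = ε`, `y₂ = 0`; dominated convergence with `|e^{-aε} - 1| ≤ aε`).
[cite: DKLM2026SixVertexGFF, Part II, Lemma 37 (i)] -/
theorem tendsto_dklmPsi_div (h : ν ∈ dklmSpaceM c C) {x₁ x₁' : ℝ} (hx₁ : 0 ≤ x₁) (hx₁' : 0 < x₁') (y₁ y₁' : ℝ) :
    Tendsto (fun ε : ℝ => (ε : ℂ)⁻¹ * dklmPsi ν x₁ y₁ x₁' y₁' ε 0) (𝓝[>] 0)
      (𝓝 (dklmF ν ((x₁ + x₁' : ℝ) : ℂ) (y₁ + y₁') - dklmF ν (x₁' : ℂ) y₁')) := by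
  -- the limit integrand and its integral
  set G : ℝ × ℝ → ℂ := fun p => -(p.1 : ℂ) * Complex.exp (-((p.1 : ℂ) * x₁' + Complex.I * p.2 * y₁')) *
    (1 - Complex.exp (-((p.1 : ℂ) * x₁ + Complex.I * p.2 * y₁))) with hG
  have hGeq : ∀ p, G p = fKernel ((x₁ + x₁' : ℝ) : ℂ) (y₁ + y₁') p - fKernel (x₁' : ℂ) y₁' p := by
    intro p
    simp only [hG, fKernel]
    rw [show -((p.1 : ℂ) * ((x₁ + x₁' : ℝ) : ℂ) + Complex.I * p.2 * ((y₁ + y₁' : ℝ) : ℂ)) =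
        -((p.1 : ℂ) * x₁' + Complex.I * p.2 * y₁') + -((p.1 : ℂ) * x₁ + Complex.I * p.2 * y₁) by push_cast; ring,
      Complex.exp_add]
    ring
  have hlimval : ∫ p, G p ∂ν = dklmF ν ((x₁ + x₁' : ℝ) : ℂ) (y₁ + y₁') - dklmF ν (x₁' : ℂ) y₁' := by
    simp only [hGeq]
    exact integral_sub (dklmSpaceM_integrable_fKernel h (by push_cast; simp; linarith) _)
      (dklmSpaceM_integrable_fKernel h (by simpa using hx₁') _)
  rw [← hlimval]
  -- the ε-integrands
  have hF : ∀ ε : ℝ, (ε : ℂ)⁻¹ * dklmPsi ν x₁ y₁ x₁' y₁' ε 0 =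
      ∫ p, (ε : ℂ)⁻¹ * chiCont x₁ y₁ x₁' y₁' ε 0 p ∂ν := fun ε => (integral_const_mul _ _).symm
  simp only [hF]
  refine tendsto_integral_filter_of_dominated_convergence (fun p => 2 * (max 1 (2 / x₁' ^ 2) * min p.1 p.1⁻¹))
    (Eventually.of_forall fun ε => (Continuous.aestronglyMeasurable (by unfold chiCont; fun_prop))) ?_
    ((dklmSpaceM_integrable_min_inv h (by positivity)).const_mul 2) ?_
  · -- domination for `ε > 0`
    filter_upwards [self_mem_nhdsWithin] with ε (hε : 0 < ε)
    filter_upwards [dklmSpaceM_ae_pos h] with p hp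
    have h1 : ‖(ε : ℂ)⁻¹ * (Complex.exp (-((p.1 : ℂ) * ε + Complex.I * p.2 * (0 : ℝ))) - 1)‖ ≤ p.1 := by
      rw [Complex.ofReal_zero, mul_zero, add_zero, show (p.1 : ℂ) * ε = ((p.1 * ε : ℝ) : ℂ) by push_cast; ring,
        norm_mul, norm_inv, Complex.norm_real, Real.norm_eq_abs, abs_of_pos hε]
      calc ε⁻¹ * ‖Complex.exp (-((p.1 * ε : ℝ) : ℂ)) - 1‖ ≤ ε⁻¹ * (p.1 * ε) := by
            gcongr; exact norm_cexp_neg_sub_one_le (by positivity)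
        _ = p.1 := by field_simp
    have h2 : ‖Complex.exp (-((p.1 : ℂ) * x₁' + Complex.I * p.2 * y₁'))‖ = Real.exp (-(p.1 * x₁')) := by
      rw [Complex.norm_exp]; congr 1; simp [Complex.mul_re, Complex.mul_im]
    have h3 : ‖(1 : ℂ) - Complex.exp (-((p.1 : ℂ) * x₁ + Complex.I * p.2 * y₁))‖ ≤ 2 := by
      refine (norm_sub_le _ _).trans ?_
      rw [norm_one, Complex.norm_exp]
      have : (-((p.1 : ℂ) * x₁ + Complex.I * p.2 * y₁)).re = -(p.1 * x₁) := by simp [Complex.mul_re, Complex.mul_im]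
      rw [this]
      have : Real.exp (-(p.1 * x₁)) ≤ 1 := Real.exp_le_one_iff.2 (by nlinarith)
      linarith
    calc ‖(ε : ℂ)⁻¹ * chiCont x₁ y₁ x₁' y₁' ε 0 p‖
        = ‖(ε : ℂ)⁻¹ * (Complex.exp (-((p.1 : ℂ) * ε + Complex.I * p.2 * (0 : ℝ))) - 1)‖ *
            ‖Complex.exp (-((p.1 : ℂ) * x₁' + Complex.I * p.2 * y₁'))‖ *
            ‖(1 : ℂ) - Complex.exp (-((p.1 : ℂ) * x₁ + Complex.I * p.2 * y₁))‖ := by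
          rw [chiCont, ← norm_mul, ← norm_mul]; ring_nf
      _ ≤ p.1 * Real.exp (-(p.1 * x₁')) * 2 := by
          rw [h2]; gcongr
      _ = 2 * (p.1 * Real.exp (-(p.1 * x₁'))) := by ring
      _ ≤ 2 * (max 1 (2 / x₁' ^ 2) * min p.1 p.1⁻¹) :=
          mul_le_mul_of_nonneg_left (mul_exp_neg_le_min_inv hp hx₁') zero_le_two
  · -- pointwise limit
    refine ae_of_all _ fun p => ?_
    have hd : HasDerivAt (fun t : ℝ => Complex.exp (-((p.1 : ℂ) * t + Complex.I * p.2 * (0 : ℝ)))) (-(p.1 : ℂ)) 0 := by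
      have h1 : HasDerivAt (fun t : ℝ => -((p.1 : ℂ) * t + Complex.I * p.2 * (0 : ℝ))) (-(p.1 : ℂ)) 0 := by
        have := (((hasDerivAt_id (0 : ℝ)).ofReal_comp).const_mul (-(p.1 : ℂ))).add_const
          (-(Complex.I * p.2 * (0 : ℝ)))
        refine (this.congr_of_eventuallyEq (Eventually.of_forall fun z => ?_)).congr_deriv (by simp)
        simp only [id]
        ring
      simpa using h1.cexp
    have hslope := hd.tendsto_slope_zero_right
    simp only [zero_add, Complex.ofReal_zero, mul_zero, add_zero, neg_zero, Complex.exp_zero] at hslope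
    have : Tendsto (fun t : ℝ => (t : ℂ)⁻¹ * (Complex.exp (-((p.1 : ℂ) * t)) - 1) *
        (Complex.exp (-((p.1 : ℂ) * x₁' + Complex.I * p.2 * y₁')) *
          (1 - Complex.exp (-((p.1 : ℂ) * x₁ + Complex.I * p.2 * y₁))))) (𝓝[>] 0)
        (𝓝 (-(p.1 : ℂ) * (Complex.exp (-((p.1 : ℂ) * x₁' + Complex.I * p.2 * y₁')) *
          (1 - Complex.exp (-((p.1 : ℂ) * x₁ + Complex.I * p.2 * y₁)))))) := by
      refine Tendsto.mul_const _ ?_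
      refine hslope.congr fun t => ?_
      rw [Complex.real_smul, Complex.ofReal_inv]
    refine (this.congr fun t => ?_).trans (by simp only [hG]; ring_nf; exact le_rfl)
    simp only [chiCont, Complex.ofReal_zero, mul_zero, add_zero]
    ring

end Literature.Probability.LatticeModels.SixVertex

end
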